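import Summits.QuantumFields.BalabanUV.T4Continuum.Support.ShellMeasureLandauEndFinal
import Summits.QuantumFields.BalabanUV.T4Continuum.Support.ShellMeasureLandauCorrectionB7Local

/-!
# `T4Continuum.ShellMeasureLandauEndFinalCf` — γ14-R11 IN KERNEL, file 2: THE END-II-FINAL OF RECORD (S76 f2
# `ShellMeasureLandauEndFinal.slotAC_realized_su2_landauChart_final`) FIRED WITH ITS LANDAU-CORRECTION SLOT SUPPLIED BY THE
# TREE's `Cf` — row S64's `C_k(U_bg, ·)` (`landauCf`), the binders `hC₂`∕`hCq`∕`hCd`∕`hCr`∕`h𝓡𝒳` DISCHARGED by file 1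
# (`ShellMeasureLandauCorrectionB7Local` §4) from the background's plaquette regularity ON THE BOXES ONLY
(cell `pub-balaban`, sub-cell `t4`, spine estimate NE7c (node U5b); NE7c ROUND-2 crew `t4-ne7c-formalise-*`, seat
`b2b-balaban-t4-ne7c-formalise-leaf-07` gen 9; own-initiative junction for owner g34's lens γ14 «which class-T rows of the ONE
CALL's census can existing tree theorems move — R11 `Cf` ⇐ S64?» (`gen34/handoff_g34.md`; journal OFFER l.20076); ADDITIVE —
imports S76 f2 `ShellMeasureLandauEndFinal` + file 1 ONLY; [folklore]; 0 `def`, 0 `def … : Prop`, 0 sorry, 0 citation tags.)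

HONEST FRAMING.  Finite four-torus programme, rung (B)+1 only — NOT infinite volume, NOT a mass gap, NOT the Clay
problem, NOT summit progress; (B), `BetaPertHyp`, (B^μ) not consumed.  NE7c (`T4IndicatorShell.ShellWeightBound`) is NOT
PRINTED and NOT PROVED; «NE7c ⇐ the named binders» (trigger c3); (M1) realized ≠ NE7c.  Nothing printed is asserted: the
equation numbers below LOCATE displayed SHAPES.  HONEST DEPENDENCY (cell): continuum YM on T⁴ ⇐ BetaPertH ∧ nine spine
estimates (0/9 proved); BetaPertH ⇐ (D1) ∧ (D4) ∧ CAP+tail; G-an2-4 gates asym, D1 and NE2/3/4.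

THE POINT (the census question answered at the END-II-final host; the u-tuple of R11).  S76 f2 takes the Landau correction
of the LOCALIZED (classifier) scheme tuple as an ABSTRACT map `Cf V : 𝒴' → 𝒳` with FIVE binders — `hC₂ : 0 ≤ C₂`,
`hCq : ∀ V Z, ‖Z‖ < RC → ‖Cf V Z‖ ≤ C₂‖Z‖²`, `hCd : ∀ V, DifferentiableOn ℂ (Cf V) (ball 0 RC)` ([Balaban1985Variational] (44) TYPE,
class [T] W-a in the owner's census), `hCr : ∀ V, ∀ Z ∈ 𝓡𝒴', Cf V Z ∈ 𝓡𝒳` and `h𝓡𝒳 : IsClosed 𝓡𝒳` (real structure).  HERE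
`𝒴' := 𝔸^{Sf}`, `𝒳 := 𝔸^{Sf′}` (`𝔸` a C⋆-algebra, e.g. `M₂(ℂ)`; `Sf`, `Sf′` finite sets of fine ∕ `Lᵏ`-bonds of `ℤᵈ`),
`Cf V := (ball 0 (landauRad d L)).indicator (landauCf L (U_bg V) k Sf Sf′)` — [B7] Prop. 4's `C_k(U_bg(V), ·)` in the
`A`-currency (row S64, p221284), cut off outside the ball where END-II never evaluates it (row S64 f2's device) — `C₂ := C2cov d
= 12·131072(d+1)²`, `RC := landauRad d L`, `𝓡𝒴' := skewPi Sf`, `𝓡𝒳 := skewPi Sf′`; the five binders are DISCHARGED by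
file 1's `landauCorrection_real_binders_local`.  WHAT REPLACES THEM (displayed, per exterior section `V`): the background
`U_bg V : ℤᵈ → (bonds) → 𝔸ˣ`, UNITARY-valued (`hUbg`, structural), PLAQUETTE-REGULAR ON THE BOXES `B^k(c₋) ∪ B^k(c₊)`,
`c ∈ Sf′`, ONLY — `h52loc : pdevOn … (U_bg V) < α₀·L^{−2k}` ([Balaban1985Averaging] (52) ∕ B11 (19)–(21) ∕ B14 (2.16) TYPE for
the localized minimiser: ONE located hypothesis of printed TYPE, NOT discharged) — and four LEVEL-FREE numbers `0 < α₀`,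
`C₀α₀ ≤ 1∕3`, `4α₀ ≤ c₂′(d,L)`, `4·O1cov(d)·α₀ ≤ 1∕3` (print's «α₀ ≦ c₄(d,L)», class [D]).  [dict] (node O, said not claimed):
`U_bg V` = the localized minimiser about the section's centre read on `ℤᵈ`, `k` = the slot's level (`η = L^{−k}`), the
`Lᵏη`-scaling display of (44) and the `Ω_j` geometry (row S64's header).  Every OTHER hypothesis is S76 f2's VERBATIM (with
`C₂ ↦ C2cov d`, `RC ↦ landauRad d L`, `𝓡𝒴' 𝓡𝒳 ↦ skewPi` in `h18`, `h3R`, `hs₁`, `ha`, `hma`, `hιr`, `hHr`, `hudict`);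
CONCLUSION IDENTICAL: (M1) per slot with `2(m₀ + (B_W + B_E))∕(1 − δ)`.  §2 THE LOCALIZED TUPLE's OWN CASE
(`slotAC_realized_su2_landauChart_final_cfB7_flat`): the classifier tuple's DEFINED plaquette variables are words of the exponent
field ALONE (`hudict`; `= 1` at the centre — WALL §2b R04 «localized minimiser flat there»), so (44)'s `C_j` for THIS tuple is
`C_k(1, ·)`: S76 f2 fired with `Cf V := (ball 0 RC).indicator (landauCf L 1 k Sf Sf′)` and the five binders DISCHARGED by file 1
§5 `landauCorrection_real_binders_flat` with NOTHING in their place — no background datum, no number, k-uniform.  NET FOR γ14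
(honest): at the END-II-final host, R11's u-tuple (6 names ∕ 3 [T] hypotheses + `hCr`) LEAVES with «0 enter» (§2) — resp. «1
located regularity hypothesis of printed TYPE enters» for a general unitary background (§1, the form the w∕e tuples of S80 f6
need: GLOBAL minimiser, frozen prefactors `B_p ≠ 1`, N-ne7cp1-g31-2); B7 Prop. 4 IS kernel (S56∕S64) — what the junction
does NOT touch is node O's identification of the slot.  File 3 (S80 f6's three tuples; u by §2's flat face, w flat +
S68 (b) locality, e by CfP `conj_binders_of_local` over file 1) on f2's ACCEPT (owner R-ne7cp1-g35-1 (b), test (x-S99)).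
-/

noncomputable section

open Set Metric NormedSpace MeasureTheory Function

namespace Summit.QuantumFields.BalabanUV.T4Continuum.ShellMeasureLandauEndFinalCf

open scoped ENNReal
open Literature.MathematicalPhysics.QuantumFieldTheory.Balaban1983to89
open B11Prop6Scheme (Prop4Hyp)
open GaugeField (GaugeInvariant)
open T4ShellMeasure (SlotAntiConcentration)
open T4CubePoincare (cube)
open T4CubeChartGnomonic (SU2)
open T4CubeChartExp (expFibreChart)
open T4TreeGaugeFixing (NoClosedLoop fixTo)
open ShellMeasureLevelAssembly (classifier)
open ShellMeasureLandauHolonomy (solAt landauExp)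
open ShellMeasureLandauHolonomyChart (holOf cplx)
open ShellMeasureLandauHolonomySkew (readOutReal)
open ShellMeasureLandauEndFinal (slotAC_realized_su2_landauChart_final)
open B7Prop2Explicit (C0 c2' unitaryUnits)
open B7Prop1Local (pdevOn loK bondHiK)
open ShellMeasureAverageProp4General (C1cov O1cov C2cov C1cov_pos)
open ShellMeasureLandauCorrectionB7 (landauCf landauRad)
open ShellMeasureLandauCorrectionReal (skewPi isClosed_skewPi)
open ShellMeasureLandauCorrectionB7Local (landauCorrection_real_binders_local landauCorrection_real_binders_flat)

section Final

open scoped Matrix.Norms.L2Operator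

variable {P : Params} {j : ℕ} [DecidableEq (PBond P j)]
variable {n : Type*} [Fintype n] [DecidableEq n] [Nonempty n]
variable {𝒴 𝒵 ℬ : Type*} [NormedAddCommGroup 𝒴] [NormedSpace ℂ 𝒴] [CompleteSpace 𝒴]
  [NormedAddCommGroup 𝒵] [NormedSpace ℂ 𝒵] [NormedAddCommGroup ℬ] [NormedSpace ℂ ℬ]
variable {𝔸 : Type*} [CStarAlgebra 𝔸] [Nontrivial 𝔸]

/-- **END-II-FINAL WITH R11 SUPPLIED — the Landau-correction slot IS the tree's `C_k(U_bg, ·)`.**  S76 f2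
`slotAC_realized_su2_landauChart_final` with `𝒴' := 𝔸^{Sf}`, `𝒳 := 𝔸^{Sf′}`,
`Cf V := (ball 0 (landauRad d L)).indicator (landauCf L (U_bg V) k Sf Sf′)`, `C₂ := C2cov d`, `RC := landauRad d L`,
`𝓡𝒴' := skewPi Sf`, `𝓡𝒳 := skewPi Sf′`: the binders `hC₂`, `hCq`, `hCd`, `hCr`, `h𝓡𝒳` are DISCHARGED (file 1
`landauCorrection_real_binders_local`, per `V`); in their place the background datum `Ubg V` (unitary-valued), its plaquette
regularity on the boxes `B^k(c₋) ∪ B^k(c₊)`, `c ∈ Sf′`, only (DISPLAYED, printed TYPE, located) and four level-free numbers on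
`α₀`; everything else VERBATIM; conclusion identical.  CONDITIONAL on every binder; nothing PRINTED asserted; NOT Bałaban's
minimiser (the identification is node O's); (M1) realized ≠ NE7c. [folklore] -/
theorem slotAC_realized_su2_landauChart_final_cfB7 {T : Finset (PBond P j)} (hT : NoClosedLoop T)
    (U₀ : GaugeField P j SU2) (Λ : Finset (PBond P j)) {m₀ : ℕ} (e : ↥Λ × Fin 3 ≃ Fin m₀)
    {S : ℝ} (hS : 0 < S) (hSπ : 3 * S ^ 2 < Real.pi ^ 2) (c : GaugeField P j SU2 → GaugeField P j SU2)
    {F : GaugeField P j SU2 → ℝ≥0∞} (hF : Measurable F) (hFi : GaugeInvariant F)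
    (hFsupp : ∀ V y, F (fixTo T U₀ (updateFinset V Λ y)) ≠ 0 →
      ∀ b (hb : b ∈ Λ), dist1 ((c V b)⁻¹ * y ⟨b, hb⟩) ≤ 2 * Real.sin (S / 2))
    {u : GaugeField P j SU2 → ℝ} (hu : Measurable u) (hui : GaugeInvariant u)
    {ι : Type*} {Pu : Finset ι} (hPu : Pu.Nonempty)
    (W : GaugeField P j SU2 → Set (Fin m₀ → ℝ)) (Jco : GaugeField P j SU2 → (Fin m₀ → ℝ) → ℝ≥0∞)
    {δ ρ β : ℝ}
    (𝒢 : GaugeField P j SU2 → (𝒵 →L[ℂ] 𝒴)) (W𝒱 : GaugeField P j SU2 → 𝒴 → 𝒵) {B₀ C₄ a₃ ε₄ : ℝ}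
    (h𝒢 : ∀ V f, ‖𝒢 V f‖ ≤ B₀ * ‖f‖) (hW : ∀ V, Prop4Hyp (W𝒱 V) C₄ a₃) (hB₀ : 0 < B₀) (hC₄ : 0 ≤ C₄)
    (hε₄ : 0 ≤ ε₄)
    {dL C₁ B₃ ε₁ : ℝ} (hdL : 0 ≤ dL) (hC₁ : 0 ≤ C₁) (hε₁ : 0 ≤ ε₁) (hB₃ : dL ≤ B₃)
    (h1 : 2 * B₀ * C₁ * B₃ * ε₁ ≤ ε₄) (h2 : 4 * ε₄ ≤ a₃) (h3 : 16 * B₀ * C₄ * ε₄ ≤ 1)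
    (H₁ : GaugeField P j SU2 → (ℬ →L[ℂ] 𝒴)) (hH₁ : ∀ V B, ‖H₁ V B‖ ≤ B₀ * ‖B‖)
    (Φ : GaugeField P j SU2 → (Fin m₀ → ℂ) → ℬ) {rΦ : ℝ} (hΦd : ∀ V, DifferentiableOn ℂ (Φ V) (ball 0 rΦ))
    (hΦ0 : ∀ V, Φ V 0 = 0) (hΦ : ∀ V, ∀ z ∈ ball (0 : Fin m₀ → ℂ) rΦ, ‖Φ V z‖ < 2 * dL * C₁ * ε₁) (hSr : S < rΦ)
    -- ══ R11 SUPPLIED (γ14): END-II's Landau-correction slot `Cf : 𝒴' → 𝒳` IS the tree's cut-off `C_k(U_bg(V), ·)` of [B7]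
    -- Prop. 4 in the `A`-currency (S64 `landauCf`, S64 f2's indicator), `𝒴' := 𝔸^{Sf}`, `𝒳 := 𝔸^{Sf′}`, `C₂ := C2cov d`,
    -- `RC := landauRad d L`; `hC₂ hCq hCd hCr h𝓡𝒳` DISCHARGED by `ShellMeasureLandauCorrectionB7Local` §4.  IN THEIR PLACE
    -- (displayed): the section's BACKGROUND `Ubg V` on `ℤᵈ` (unitary-valued), its plaquette regularity ON THE BOXES
    -- `B^k(c₋) ∪ B^k(c₊)`, `c ∈ Sf′` ONLY (B11 (19)–(21) ∕ B14 (2.16) TYPE for the localized minimiser — [T], LOCATED; [dict]: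
    -- `Ubg V` = that minimiser about the centre, `k` = the slot's level, node O), and four LEVEL-FREE numbers on `α₀` ══
    (k : ℕ) (Sf Sf' : Finset (B7Prop1Explicit.Site P.d × Fin P.d))
    (Ubg : GaugeField P j SU2 → B7Prop1Explicit.Site P.d → Fin P.d → 𝔸ˣ) (hUbg : ∀ V x κ, Ubg V x κ ∈ unitaryUnits 𝔸)
    {α₀ : ℝ} (hα : 0 < α₀) (hα3 : C0 P.d * α₀ ≤ 1 / 3) (hα4 : 4 * α₀ ≤ c2' P.d P.L) (hα6 : 4 * O1cov P.d * α₀ ≤ 1 / 3)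
    (h52loc : ∀ V (c : ↥Sf'), pdevOn (loK P.L k c.1.1) (bondHiK P.L k c.1.1 c.1.2) (Ubg V) < α₀ * (((P.L : ℝ) ^ k)⁻¹) ^ 2)
    (ιs : GaugeField P j SU2 → (𝒴 →L[ℂ] (↥Sf → 𝔸))) (hι : ∀ V Y, ‖ιs V Y‖ ≤ ‖Y‖)
    (Hop : GaugeField P j SU2 → ((↥Sf' → 𝔸) →L[ℂ] 𝒴)) (hH : ∀ V X, ‖Hop V X‖ ≤ B₀ * ‖X‖)
    {ε₃ : ℝ} (h18 : 18 * C2cov P.d * B₀ * ε₃ ≤ 1) (hcoup : ε₄ + B₀ * (2 * dL * C₁ * ε₁) ≤ ε₃)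
    (h3R : 3 * ε₃ ≤ landauRad P.d P.L)
    (ℓs : ι → List (𝒴 →L[ℂ] Matrix n n ℂ)) {κr : ℝ} (hκ : 0 ≤ κr)
    (hℓ : ∀ p ∈ Pu, ∀ ℓ ∈ ℓs p, ∀ Y, ‖ℓ Y‖ ≤ κr * ‖Y‖) {m : ℕ} (hlen : ∀ p ∈ Pu, (ℓs p).length ≤ m)
    {κc : ℝ} (hκc : 0 ≤ κc) (hcurl : ∀ p ∈ Pu, ∀ Y, ‖((ℓs p).map fun ℓ => ℓ Y).sum‖ ≤ κc * ‖Y‖)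
    -- THE TWO 𝓔-SLOTS (R-ne7cp1-g31-1): the WILSON part `𝓔W` (S74 `hE_landau_wilsonSquares(_pinned)` fills `hEW`; the Wilson
    -- density is nonnegative: `hWlb`) and the NON-WILSON part `𝓔E` (S71 f2 ∕ S78 fills `hEE`; a displayed lower bound `hElb`)
    (𝓔W 𝓔E : GaugeField P j SU2 → (Fin m₀ → ℝ) → ℝ) {BW BE BElb : ℝ}
    (hEW : ∀ V, ∀ x ∈ W V, ∀ c' : ℝ, 1 / 2 ≤ c' → c' ≤ 1 → 𝓔W V (c' • x) ≤ 𝓔W V x + (1 - c') * BW) (hBW : 0 ≤ BW)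
    (hEE : ∀ V, ∀ x ∈ W V, ∀ c' : ℝ, 1 / 2 ≤ c' → c' ≤ 1 → 𝓔E V (c' • x) ≤ 𝓔E V x + (1 - c') * BE) (hBE : 0 ≤ BE)
    (hWlb : ∀ V (y : Fin m₀ → ℝ), ‖y‖ ≤ S → 0 ≤ 𝓔W V y)
    (hElb : ∀ V (y : Fin m₀ → ℝ), ‖y‖ ≤ S → -BElb ≤ 𝓔E V y)
    (L : Set (𝒴 →L[ℂ] Matrix n n ℂ))
    (𝓡𝒵 : AddSubgroup 𝒵) (𝓡ℬ : AddSubgroup ℬ)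
    (h𝒢r : ∀ V, ∀ f ∈ 𝓡𝒵, 𝒢 V f ∈ readOutReal L) (hWr : ∀ V, ∀ Y ∈ readOutReal L, W𝒱 V Y ∈ 𝓡𝒵)
    (hιr : ∀ V, ∀ Y ∈ readOutReal L, ιs V Y ∈ skewPi ↥Sf)
    (hHr : ∀ V, ∀ X ∈ skewPi (𝔸 := 𝔸) ↥Sf', Hop V X ∈ readOutReal L)
    (hH₁r : ∀ V, ∀ B ∈ 𝓡ℬ, H₁ V B ∈ readOutReal L)
    (hΦr : ∀ V, ∀ y : Fin m₀ → ℝ, ‖y‖ ≤ S → Φ V (cplx y) ∈ 𝓡ℬ)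
    (hRdict : ∀ V, ∀ x ∈ cube m₀ S,
      F (fixTo T U₀ (updateFinset V Λ (expFibreChart Λ (c V) e x))) =
        Jco V x * ENNReal.ofReal (Real.exp (-(𝓔W V x + 𝓔E V x))))
    (hudict : ∀ V, ∀ x ∈ cube m₀ S,
      u (fixTo T U₀ (updateFinset V Λ (expFibreChart Λ (c V) e x))) =
        classifier hPu (fun p => holOf (ℓs p) (fun y =>
          landauExp ((ball (0 : ↥Sf → 𝔸) (landauRad P.d P.L)).indicator (landauCf P.L (Ubg V) k Sf Sf')) (ιs V) (Hop V)
          (4 * C2cov P.d * (ε₄ + B₀ * (2 * dL * C₁ * ε₁)) ^ 2)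
          (solAt (𝒢 V) 0 (W𝒱 V) ε₄ (0 : 𝒵) (H₁ V (Φ V (cplx y))) + H₁ V (Φ V (cplx y))))) x)
    (hJW : ∀ V x, Jco V x ≠ 0 → x ∈ W V)
    (hJ : ∀ V x, ∀ a : ℝ, 0 ≤ a → Jco V x ≤ Jco V (Real.exp (-a) • x))
    (hJ1 : ∀ V x, Jco V x ≤ 1)
    (hWS : ∀ V, W V ⊆ closedBall (0 : Fin m₀ → ℝ) S)
    (hδ0 : 0 ≤ δ) (hδ1 : δ < 1) (hρ0 : 0 ≤ ρ) (hρ : ρ ≤ (1 - δ) / 2) (hβ : 0 ≤ β)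
    -- SM-L2 (SM) DISCHARGED IN THE STOKES CURRENCY (S73 `hSM_of_stokes`): the η-scalings of the classifier's read-out data
    -- DISPLAYED — curl read-out × field size `κ_c·z̄ ≤ c₁η²z` (B11 (25)∕(37) TYPE), letter size `κ_r·z̄ ≤ c₂ηz` ((19) TYPE),
    -- regime `m·κ_r·z̄ ≤ 1` — the UNIT-currency smallness `36(c₁z + m²c₂²z²)∕(r_Φ∕S − 1)² ≤ δ·εθ`, and the classifier
    -- threshold `θ := εθ·η²` (B14 (2.17) TYPE): the `η²` CANCELS
    {η εθ c₁ c₂ z : ℝ} (hη : 0 < η) (hεθ : 0 < εθ)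
    (hs₁ : κc * ((ε₄ + B₀ * (2 * dL * C₁ * ε₁)) + B₀ * (4 * C2cov P.d * (ε₄ + B₀ * (2 * dL * C₁ * ε₁)) ^ 2)) ≤
      c₁ * η ^ 2 * z)
    (ha : κr * ((ε₄ + B₀ * (2 * dL * C₁ * ε₁)) + B₀ * (4 * C2cov P.d * (ε₄ + B₀ * (2 * dL * C₁ * ε₁)) ^ 2)) ≤ c₂ * η * z)
    (hma : m * (κr * ((ε₄ + B₀ * (2 * dL * C₁ * ε₁)) + B₀ * (4 * C2cov P.d * (ε₄ + B₀ * (2 * dL * C₁ * ε₁)) ^ 2))) ≤ 1)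
    (hsm : 36 * (c₁ * z + m ^ 2 * c₂ ^ 2 * z ^ 2) / (rΦ / S - 1) ^ 2 ≤ δ * εθ) :
    SlotAntiConcentration ((fieldMeasure P j SU2).withDensity F) u (εθ * η ^ 2) ρ
      (2 * ((m₀ : ℝ) + (BW + BE)) / (1 - δ))  := by
  have hL2 : 2 ≤ P.L := P.hL.2
  have hC2 : 0 ≤ C2cov P.d := by
    have hC := C1cov_pos P.d
    unfold C2cov; positivity
  have hR := fun V : GaugeField P j SU2 =>
    landauCorrection_real_binders_local hL2 k (Ubg V) (hUbg V) hα hα3 hα4 hα6 Sf Sf' (h52loc V)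
  exact slotAC_realized_su2_landauChart_final hT U₀ Λ e hS hSπ c hF hFi hFsupp hu hui hPu W Jco 𝒢 W𝒱 h𝒢 hW hB₀ hC₄ hε₄
    hdL hC₁ hε₁ hB₃ h1 h2 h3 H₁ hH₁ Φ hΦd hΦ0 hΦ hSr
    (fun V => (ball (0 : ↥Sf → 𝔸) (landauRad P.d P.L)).indicator (landauCf P.L (Ubg V) k Sf Sf')) hC2
    (fun V => (hR V).1) (fun V => (hR V).2.1) ιs hι Hop hH h18 hcoup h3R ℓs hκ hℓ hlen hκc hcurl 𝓔W 𝓔E hEW hBW hEE hBE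
    hWlb hElb L 𝓡𝒵 (skewPi ↥Sf) (skewPi ↥Sf') (isClosed_skewPi _) 𝓡ℬ h𝒢r hWr hιr hHr (fun V => (hR V).2.2.1) hH₁r hΦr
    hRdict hudict hJW hJ hJ1 hWS hδ0 hδ1 hρ0 hρ hβ hη hεθ hs₁ ha hma hsm


/-- **END-II-FINAL WITH R11 DISCHARGED OUTRIGHT — THE LOCALIZED TUPLE's LANDAU CORRECTION IS `C_k(1, ·)`.**  The localized
(classifier) tuple's DEFINED plaquette variables are `holOf (ℓs p) Z` of the exponent field `Z` ALONE (`hudict`; `Z = 0`, all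
variables `= 1`, at the chart centre — WALL §2b R04 «localized minimiser flat there»), so [Balaban1985Variational] (44)'s `C_j`
for this tuple is B7's `C_k` about the FLAT background: S76 f2 fired with
`Cf V := (ball 0 (landauRad d L)).indicator (landauCf L 1 k Sf Sf′)`, `C₂ := C2cov d`, `RC := landauRad d L`,
`𝓡𝒴' := skewPi Sf`, `𝓡𝒳 := skewPi Sf′` — `hC₂ hCq hCd hCr h𝓡𝒳` DISCHARGED by file 1's `landauCorrection_real_binders_flat`
with NOTHING in their place (k-uniform, no background hypothesis, no number).  Every other hypothesis S76 f2's VERBATIM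
(`C₂ ↦ C2cov d`, `RC ↦ landauRad d L`, real structure `skewPi`); conclusion identical.  NET (honest): R11's u-tuple — «3 [T]
leave, 0 enter»; the identification of the slot with `C_k(1, ·)` on the block's bonds is node O's [dict]; (M1) realized ≠
NE7c; nothing of Bałaban's at a live level is discharged by this (B7 Prop. 4 IS kernel, S56∕S64). [folklore] -/
theorem slotAC_realized_su2_landauChart_final_cfB7_flat {T : Finset (PBond P j)} (hT : NoClosedLoop T)
    (U₀ : GaugeField P j SU2) (Λ : Finset (PBond P j)) {m₀ : ℕ} (e : ↥Λ × Fin 3 ≃ Fin m₀)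
    {S : ℝ} (hS : 0 < S) (hSπ : 3 * S ^ 2 < Real.pi ^ 2) (c : GaugeField P j SU2 → GaugeField P j SU2)
    {F : GaugeField P j SU2 → ℝ≥0∞} (hF : Measurable F) (hFi : GaugeInvariant F)
    (hFsupp : ∀ V y, F (fixTo T U₀ (updateFinset V Λ y)) ≠ 0 →
      ∀ b (hb : b ∈ Λ), dist1 ((c V b)⁻¹ * y ⟨b, hb⟩) ≤ 2 * Real.sin (S / 2))
    {u : GaugeField P j SU2 → ℝ} (hu : Measurable u) (hui : GaugeInvariant u)
    {ι : Type*} {Pu : Finset ι} (hPu : Pu.Nonempty)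
    (W : GaugeField P j SU2 → Set (Fin m₀ → ℝ)) (Jco : GaugeField P j SU2 → (Fin m₀ → ℝ) → ℝ≥0∞)
    {δ ρ β : ℝ}
    (𝒢 : GaugeField P j SU2 → (𝒵 →L[ℂ] 𝒴)) (W𝒱 : GaugeField P j SU2 → 𝒴 → 𝒵) {B₀ C₄ a₃ ε₄ : ℝ}
    (h𝒢 : ∀ V f, ‖𝒢 V f‖ ≤ B₀ * ‖f‖) (hW : ∀ V, Prop4Hyp (W𝒱 V) C₄ a₃) (hB₀ : 0 < B₀) (hC₄ : 0 ≤ C₄)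
    (hε₄ : 0 ≤ ε₄)
    {dL C₁ B₃ ε₁ : ℝ} (hdL : 0 ≤ dL) (hC₁ : 0 ≤ C₁) (hε₁ : 0 ≤ ε₁) (hB₃ : dL ≤ B₃)
    (h1 : 2 * B₀ * C₁ * B₃ * ε₁ ≤ ε₄) (h2 : 4 * ε₄ ≤ a₃) (h3 : 16 * B₀ * C₄ * ε₄ ≤ 1)
    (H₁ : GaugeField P j SU2 → (ℬ →L[ℂ] 𝒴)) (hH₁ : ∀ V B, ‖H₁ V B‖ ≤ B₀ * ‖B‖)
    (Φ : GaugeField P j SU2 → (Fin m₀ → ℂ) → ℬ) {rΦ : ℝ} (hΦd : ∀ V, DifferentiableOn ℂ (Φ V) (ball 0 rΦ))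
    (hΦ0 : ∀ V, Φ V 0 = 0) (hΦ : ∀ V, ∀ z ∈ ball (0 : Fin m₀ → ℂ) rΦ, ‖Φ V z‖ < 2 * dL * C₁ * ε₁) (hSr : S < rΦ)
    -- ══ R11 SUPPLIED AT THE FLAT BACKGROUND (the LOCALIZED tuple's own case): `Cf V := (ball 0 RC).indicator (C_k(1, ·))`,
    -- `C₂ := C2cov d`, `RC := landauRad d L`; `hC₂ hCq hCd hCr h𝓡𝒳` DISCHARGED by file 1 §5 with NO background datum and NO
    -- number — the only new data are the index sets `Sf`, `Sf′` and the depth `k` ([dict]: `k` = the slot's level) ══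
    (k : ℕ) (Sf Sf' : Finset (B7Prop1Explicit.Site P.d × Fin P.d))
    (ιs : GaugeField P j SU2 → (𝒴 →L[ℂ] (↥Sf → 𝔸))) (hι : ∀ V Y, ‖ιs V Y‖ ≤ ‖Y‖)
    (Hop : GaugeField P j SU2 → ((↥Sf' → 𝔸) →L[ℂ] 𝒴)) (hH : ∀ V X, ‖Hop V X‖ ≤ B₀ * ‖X‖)
    {ε₃ : ℝ} (h18 : 18 * C2cov P.d * B₀ * ε₃ ≤ 1) (hcoup : ε₄ + B₀ * (2 * dL * C₁ * ε₁) ≤ ε₃)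
    (h3R : 3 * ε₃ ≤ landauRad P.d P.L)
    (ℓs : ι → List (𝒴 →L[ℂ] Matrix n n ℂ)) {κr : ℝ} (hκ : 0 ≤ κr)
    (hℓ : ∀ p ∈ Pu, ∀ ℓ ∈ ℓs p, ∀ Y, ‖ℓ Y‖ ≤ κr * ‖Y‖) {m : ℕ} (hlen : ∀ p ∈ Pu, (ℓs p).length ≤ m)
    {κc : ℝ} (hκc : 0 ≤ κc) (hcurl : ∀ p ∈ Pu, ∀ Y, ‖((ℓs p).map fun ℓ => ℓ Y).sum‖ ≤ κc * ‖Y‖)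
    -- THE TWO 𝓔-SLOTS (R-ne7cp1-g31-1): the WILSON part `𝓔W` (S74 `hE_landau_wilsonSquares(_pinned)` fills `hEW`; the Wilson
    -- density is nonnegative: `hWlb`) and the NON-WILSON part `𝓔E` (S71 f2 ∕ S78 fills `hEE`; a displayed lower bound `hElb`)
    (𝓔W 𝓔E : GaugeField P j SU2 → (Fin m₀ → ℝ) → ℝ) {BW BE BElb : ℝ}
    (hEW : ∀ V, ∀ x ∈ W V, ∀ c' : ℝ, 1 / 2 ≤ c' → c' ≤ 1 → 𝓔W V (c' • x) ≤ 𝓔W V x + (1 - c') * BW) (hBW : 0 ≤ BW)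
    (hEE : ∀ V, ∀ x ∈ W V, ∀ c' : ℝ, 1 / 2 ≤ c' → c' ≤ 1 → 𝓔E V (c' • x) ≤ 𝓔E V x + (1 - c') * BE) (hBE : 0 ≤ BE)
    (hWlb : ∀ V (y : Fin m₀ → ℝ), ‖y‖ ≤ S → 0 ≤ 𝓔W V y)
    (hElb : ∀ V (y : Fin m₀ → ℝ), ‖y‖ ≤ S → -BElb ≤ 𝓔E V y)
    (L : Set (𝒴 →L[ℂ] Matrix n n ℂ))
    (𝓡𝒵 : AddSubgroup 𝒵) (𝓡ℬ : AddSubgroup ℬ)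
    (h𝒢r : ∀ V, ∀ f ∈ 𝓡𝒵, 𝒢 V f ∈ readOutReal L) (hWr : ∀ V, ∀ Y ∈ readOutReal L, W𝒱 V Y ∈ 𝓡𝒵)
    (hιr : ∀ V, ∀ Y ∈ readOutReal L, ιs V Y ∈ skewPi ↥Sf)
    (hHr : ∀ V, ∀ X ∈ skewPi (𝔸 := 𝔸) ↥Sf', Hop V X ∈ readOutReal L)
    (hH₁r : ∀ V, ∀ B ∈ 𝓡ℬ, H₁ V B ∈ readOutReal L)
    (hΦr : ∀ V, ∀ y : Fin m₀ → ℝ, ‖y‖ ≤ S → Φ V (cplx y) ∈ 𝓡ℬ)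
    (hRdict : ∀ V, ∀ x ∈ cube m₀ S,
      F (fixTo T U₀ (updateFinset V Λ (expFibreChart Λ (c V) e x))) =
        Jco V x * ENNReal.ofReal (Real.exp (-(𝓔W V x + 𝓔E V x))))
    (hudict : ∀ V, ∀ x ∈ cube m₀ S,
      u (fixTo T U₀ (updateFinset V Λ (expFibreChart Λ (c V) e x))) =
        classifier hPu (fun p => holOf (ℓs p) (fun y =>
          landauExp ((ball (0 : ↥Sf → 𝔸) (landauRad P.d P.L)).indicator
            (landauCf P.L (1 : B7Prop1Explicit.Site P.d → Fin P.d → 𝔸ˣ) k Sf Sf')) (ιs V) (Hop V)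
          (4 * C2cov P.d * (ε₄ + B₀ * (2 * dL * C₁ * ε₁)) ^ 2)
          (solAt (𝒢 V) 0 (W𝒱 V) ε₄ (0 : 𝒵) (H₁ V (Φ V (cplx y))) + H₁ V (Φ V (cplx y))))) x)
    (hJW : ∀ V x, Jco V x ≠ 0 → x ∈ W V)
    (hJ : ∀ V x, ∀ a : ℝ, 0 ≤ a → Jco V x ≤ Jco V (Real.exp (-a) • x))
    (hJ1 : ∀ V x, Jco V x ≤ 1)
    (hWS : ∀ V, W V ⊆ closedBall (0 : Fin m₀ → ℝ) S)
    (hδ0 : 0 ≤ δ) (hδ1 : δ < 1) (hρ0 : 0 ≤ ρ) (hρ : ρ ≤ (1 - δ) / 2) (hβ : 0 ≤ β)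
    -- SM-L2 (SM) DISCHARGED IN THE STOKES CURRENCY (S73 `hSM_of_stokes`): the η-scalings of the classifier's read-out data
    -- DISPLAYED — curl read-out × field size `κ_c·z̄ ≤ c₁η²z` (B11 (25)∕(37) TYPE), letter size `κ_r·z̄ ≤ c₂ηz` ((19) TYPE),
    -- regime `m·κ_r·z̄ ≤ 1` — the UNIT-currency smallness `36(c₁z + m²c₂²z²)∕(r_Φ∕S − 1)² ≤ δ·εθ`, and the classifier
    -- threshold `θ := εθ·η²` (B14 (2.17) TYPE): the `η²` CANCELS
    {η εθ c₁ c₂ z : ℝ} (hη : 0 < η) (hεθ : 0 < εθ)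
    (hs₁ : κc * ((ε₄ + B₀ * (2 * dL * C₁ * ε₁)) + B₀ * (4 * C2cov P.d * (ε₄ + B₀ * (2 * dL * C₁ * ε₁)) ^ 2)) ≤
      c₁ * η ^ 2 * z)
    (ha : κr * ((ε₄ + B₀ * (2 * dL * C₁ * ε₁)) + B₀ * (4 * C2cov P.d * (ε₄ + B₀ * (2 * dL * C₁ * ε₁)) ^ 2)) ≤ c₂ * η * z)
    (hma : m * (κr * ((ε₄ + B₀ * (2 * dL * C₁ * ε₁)) + B₀ * (4 * C2cov P.d * (ε₄ + B₀ * (2 * dL * C₁ * ε₁)) ^ 2))) ≤ 1)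
    (hsm : 36 * (c₁ * z + m ^ 2 * c₂ ^ 2 * z ^ 2) / (rΦ / S - 1) ^ 2 ≤ δ * εθ) :
    SlotAntiConcentration ((fieldMeasure P j SU2).withDensity F) u (εθ * η ^ 2) ρ
      (2 * ((m₀ : ℝ) + (BW + BE)) / (1 - δ))  := by
  have hL2 : 2 ≤ P.L := P.hL.2
  have hC2 : 0 ≤ C2cov P.d := by
    have hC := C1cov_pos P.d
    unfold C2cov; positivity
  have hR := landauCorrection_real_binders_flat (𝔸 := 𝔸) (d := P.d) hL2 k Sf Sf'
  exact slotAC_realized_su2_landauChart_final hT U₀ Λ e hS hSπ c hF hFi hFsupp hu hui hPu W Jco 𝒢 W𝒱 h𝒢 hW hB₀ hC₄ hε₄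
    hdL hC₁ hε₁ hB₃ h1 h2 h3 H₁ hH₁ Φ hΦd hΦ0 hΦ hSr
    (fun _ => (ball (0 : ↥Sf → 𝔸) (landauRad P.d P.L)).indicator
      (landauCf P.L (1 : B7Prop1Explicit.Site P.d → Fin P.d → 𝔸ˣ) k Sf Sf')) hC2
    (fun _ => hR.1) (fun _ => hR.2.1) ιs hι Hop hH h18 hcoup h3R ℓs hκ hℓ hlen hκc hcurl 𝓔W 𝓔E hEW hBW hEE hBE
    hWlb hElb L 𝓡𝒵 (skewPi ↥Sf) (skewPi ↥Sf') (isClosed_skewPi _) 𝓡ℬ h𝒢r hWr hιr hHr (fun _ => hR.2.2.1) hH₁r hΦr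
    hRdict hudict hJW hJ hJ1 hWS hδ0 hδ1 hρ0 hρ hβ hη hεθ hs₁ ha hma hsm

end Final

end Summit.QuantumFields.BalabanUV.T4Continuum.ShellMeasureLandauEndFinalCf

end
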